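import Mathlib
import Literature.MathematicalPhysics.QuantumFieldTheory.Balaban1983to89.Beta.TorusG0Kernel

/-!
# Beta / TorusG0GradDecay — `η`-uniform `L²` set-to-set decay of the lattice GRADIENT `∇^η G₀`,
`G₀ = (−Δ^η + a Q*Q)⁻¹`, on the torus type (Combes–Thomas, ENERGY form)

HONEST FRAMING (verbatim, page 1 of everything this cell writes): discharging `BetaPertH` makes Bałaban's UV
stability UNCONDITIONAL — a real constructive-QFT result; it is NOT the continuum limit and NOT the Clay problem.
Gloss (BETA-SPEC v1.9b l. 17–18, G-ref2-14 (a) / G-ref2-20 (a), verbatim): «UNCONDITIONAL» in [Balaban1989LargeFieldII]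
(B16, CMP 122) p. 355's interval-hypothesis sense ONLY (`FlowStepRuns.p355Unconditional_of_partialSums` keeps `hnodes`);
the located leaves G-adv3-2 (left inequality of (0.1)/(2.50), d = 4), G-adv3-1 (U2 transfer of B14 Cor. 3's lower
bound) and `SecondExpLeaf` REMAIN.  Gloss 2 (BETA-SPEC v1.9e 22:38Z, beta-ref C-beta-78, BINDING, verbatim): «UNCONDITIONAL» =
`Beta.Assembly.EventualForm`-unconditional — the END statement with the interval hypothesis removed, (0.31) in DEFECTED form
on all lattices (`PrefixAbsorption.thm2Defected_of_eventualForm`), admissible couplings shrunk to g ≤ g⋆; NOT «B12 Theorem 2 as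
printed» (that needs (AF-0s) or (AF-0-L) ∀k at L ≥ L₁ in addition: `eventualForm_not_thm2Printed`, RULING (R6)); never the
continuum limit / mass gap / Clay.  THIS MODULE discharges nothing of that and makes NO UV-stability claim at all: it
is a Mathlib-elementary kernel certificate (v1.0.1/v1.0.2 = v1 + this paragraph, docstring-only — beta-ref R129/R150,
ref2 G-ref2-20 (a); no declaration changed).

SCOPE.  Mathlib-elementary; nothing printed by Bałaban is asserted, no hypothesis is a quotation.  The
siblings prove, for `H = lap c + Σ_b m_b u_b ⊗ u_b` coercive with constant `σ` and a weight `φ` whose conjugation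
defect is form-bounded by `σ/2`:  `‖e^{φ} v‖ ≤ (2/σ)‖e^{φ} g‖` for `Hv = g` (`CombesThomasFormOp.combesThomas_form_op`),
whence the set-to-set decay of `H⁻¹` (`setDecay_lattice_dist`; on the torus `TorusG0Decay.setDecay_torus`,
`TorusG0Kernel.G0_setDecay`).  THIS MODULE adds the ENERGY form of the same argument and harvests the gradient:

* §1 `combesThomas_energy_op`: under the SAME two hypotheses, `⟨w, Hw⟩ ≤ (4/σ) ‖e^{φ} g‖²` for `w = e^{φ} v`
  (from `⟨w,Hw⟩ + defect(w) = ⟨w, e^{φ}g⟩`, the defect bound, Cauchy–Schwarz and the sibling's `‖w‖ ≤ (2/σ)‖e^{φ}g‖`);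
* §2 `form_lap_add_blocks` / `gradSq_le_form`: `⟨w,Hw⟩ = ½ Σ_{j,k} c_jk (w_j − w_k)² + Σ_b m_b ⟨u_b,w⟩² ≥ ½ Σ c_jk (w_j − w_k)²`
  (`lap_form` + `BlockPoincare.quadForm_rankOne_sum`);
* §3 `weightedGradSq_le`: the bond algebra `e^{φ_j}(v_j − v_k) = (w_j − w_k) − (e^{φ_j−φ_k} − 1) w_k` with
  `|e^{φ_j−φ_k} − 1| ≤ ε` across bonds and row sums `Σ_j c_jk ≤ ρ` gives
  `Σ_{j,k} c_jk (e^{φ_j}(v_j − v_k))² ≤ (16/σ + 8ε²ρ/σ²) ‖e^{φ}g‖²`; `gradDecay_set_form_op`: hence for `g` supported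
  in `T` (`φ ≤ hi` there) and `lo ≤ φ` on `S`: `Σ_{j∈S} Σ_k c_jk (v_j − v_k)² ≤ (16/σ + 8ε²ρ/σ²) e^{−2(lo−hi)} ‖g‖²`;
* §4 `gradDecay_lattice_dist`: in the lattice shape of `setDecay_lattice_dist` (bond coefficient `η⁻²`, `≤ z`
  neighbours, bond length `≤ η`, blocks of diameter `≤ D`, strengths `≤ a`, `0 ≤ δ`, `δη ≤ 1`,
  `zδ² + a(e^{δD} − 1) ≤ σ/2`, weight `δ·dist(·,T)`): `ε = 2δη`, `ρ = zη⁻²`, so the constant is `16/σ + 32zδ²/σ²` —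
  AGAIN `η`-FREE: `Σ_{j∈S} Σ_k c_jk (v_j − v_k)² ≤ (16/σ + 32zδ²/σ²) e^{−2δR} Σ_j g_j²`;
* §5 on `T_η = Tor (fine (n+1) M)` (periods `≥ 3`, `a > 0`, `H = torusOp n M a = −Δ^η + aQ*Q`): `sum_coupling_mul`
  (`Σ_k c_xk F(k) = (n+1)² Σ_μ (F(x+e_μ) + F(x−e_μ))`), **`gradDecay_torus`** / **`G0_gradDecay`**:
  `Σ_{x∈S} (n+1)² Σ_μ [(v(x) − v(x+e_μ))² + (v(x) − v(x−e_μ))²] ≤ (32/min(2,a)) e^{−2δR} Σ_x g(x)²` for `v = G₀ g`,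
  `g` supported in `T ≠ ∅`, `edist(S,T) ≥ R`, `0 ≤ δ ≤ 1`, `2dδ² + a(e^δ − 1) ≤ min(2,a)/2` — the `η`-uniform `L²`
  set-to-set decay of the forward/backward lattice gradients `∇^η_{±μ} G₀ = η⁻¹(G₀(·±e_μ) − G₀(·))`; and the entry
  form **`G0_grad_entry_bound`**: `(n+1)|G₀(x,y) − G₀(x+e_μ,y)| ≤ √(32/min(2,a)) · e^{−δ·edist(x,y)}`.

WHAT IT DOES NOT GIVE.  (i) `∇^η G₀ ∇^η*` and `∇∇G₀` (two derivatives need the `H^{−1} → H^{1}` duality form, not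
here); (ii) covariant (gauge-field dependent, `U ≠ 1`) Laplacians and the non-local members of Bałaban's class `𝒦_k`;
(iii) any short-distance gain (`ℓ²`-type constants only, as in the siblings); (iv) periods `≤ 2`.  B5 = T. Bałaban,
Commun. Math. Phys. 95 (1984) 17–40 [Balaban1984PropagatorsI] is CONTEXT only ((1.18) p. 20).  Device reference:
Combes–Thomas [CombesThomas1973, §II] via the imported modules.  Unit `b2b-balaban-pv23-g3` (surge node prover #23,
gen 3; journal claim BETA-TORUS-G0-GRAD-DECAY); census C-pv23g3-11 (GAPS.md); staged byte-identically under
`HOME/lean/BalabanYm4/`.  Value = kernel certificate, NOT summit progress.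
-/

open Finset Matrix

namespace Literature.MathematicalPhysics.QuantumFieldTheory.Balaban1983to89.Beta.TorusG0GradDecay

open B5Prop11Plancherel (Tor fine unitVec)
open CombesThomasForm (lap lap_apply lap_mulVec lap_form)
open CombesThomasFormOp (combesThomas_form_op weightedSq_le_of_support distTo distTo_le le_distTo
  distTo_le_zero_of_mem abs_distTo_sub_le)
open BlockPoincare (quadForm_rankOne_sum)
open TorusG0Decay (torusOp coupling coupling_symm coupling_nonneg coupling_bond adj_of_coupling_ne_zero
  card_coupling_ne_zero_le filter_adj_eq_image pm_injective coercive_torus edist ldist ldist_self ldist_symm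
  ldist_triangle ldist_le_one_of_adj ldist_le_of_same_block sum_blockInd_sq card_block_ne_zero)
open TorusG0Kernel (G0 torusOp_mulVec_G0 G0_mulVec_single sum_single_sq)

noncomputable section

/-! ## §1  Combes–Thomas, ENERGY form -/

section Generic

variable {ι : Type*} [Fintype ι]

/-- **Combes–Thomas, energy form.**  Under the two hypotheses of `combesThomas_form_op` (coercivity `σ‖ω‖² ≤ ⟨ω,Hω⟩`,
conjugation defect `≥ −(σ/2)‖w‖²`), for every solution of `Hv = g` the conjugated solution `w = e^{φ} v` has ENERGY
`⟨w, Hw⟩ ≤ (4/σ) Σ_j (e^{φ_j} g_j)²`.  Proof: `⟨w,Hw⟩ + defect(w) = ⟨w, e^{φ}g⟩ ≤ ‖w‖‖e^{φ}g‖ ≤ (2/σ)‖e^{φ}g‖²` and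
`−defect ≤ (σ/2)‖w‖² ≤ (2/σ)‖e^{φ}g‖²`. [cite: CombesThomas1973, §II] [folklore] -/
theorem combesThomas_energy_op (H : Matrix ι ι ℝ) (σ : ℝ) (φ : ι → ℝ) (hσ : 0 < σ)
    (hpos : ∀ ω : ι → ℝ, σ * (ω ⬝ᵥ ω) ≤ ω ⬝ᵥ H.mulVec ω)
    (herr : ∀ w : ι → ℝ,
      -(σ / 2) * (w ⬝ᵥ w) ≤ ∑ j, ∑ k, (Real.exp (φ j - φ k) - 1) * H j k * (w j * w k))
    (g v : ι → ℝ) (hv : H.mulVec v = g) :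
    (fun j => Real.exp (φ j) * v j) ⬝ᵥ H.mulVec (fun j => Real.exp (φ j) * v j)
      ≤ 4 / σ * ∑ j, (Real.exp (φ j) * g j) ^ 2 := by
  have hσ0 : σ ≠ 0 := hσ.ne'
  have hST := combesThomas_form_op H σ φ hσ hpos herr g v hv
  set S : ℝ := ∑ j, (Real.exp (φ j) * v j) ^ 2 with hS
  set T : ℝ := ∑ j, (Real.exp (φ j) * g j) ^ 2 with hT
  set w : ι → ℝ := fun j => Real.exp (φ j) * v j with hw
  set G : ι → ℝ := fun j => Real.exp (φ j) * g j with hG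
  have hEAv : ∀ j, Real.exp (φ j) * (H.mulVec v) j = ∑ k, Real.exp (φ j - φ k) * H j k * w k := by
    intro j
    simp only [mulVec, dotProduct, hw, Finset.mul_sum, Real.exp_sub]
    refine Finset.sum_congr rfl fun k _ => ?_
    field_simp
  have hlhs : ∑ j, w j * (Real.exp (φ j) * (H.mulVec v) j) = w ⬝ᵥ G := by
    simp only [hv, hG, dotProduct]
  have hsplit : ∑ j, w j * (Real.exp (φ j) * (H.mulVec v) j) =
      w ⬝ᵥ H.mulVec w + ∑ j, ∑ k, (Real.exp (φ j - φ k) - 1) * H j k * (w j * w k) := by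
    have h0 : ∑ j, w j * (Real.exp (φ j) * (H.mulVec v) j) =
        ∑ j, w j * ∑ k, Real.exp (φ j - φ k) * H j k * w k :=
      Finset.sum_congr rfl fun j _ => by rw [hEAv j]
    rw [h0]
    simp only [dotProduct, mulVec, Finset.mul_sum, ← Finset.sum_add_distrib]
    refine Finset.sum_congr rfl fun j _ => Finset.sum_congr rfl fun k _ => by ring
  have hT0 : 0 ≤ T := Finset.sum_nonneg fun j _ => sq_nonneg _
  have hww : w ⬝ᵥ w = S := by
    simp only [dotProduct, hS, hw]; exact Finset.sum_congr rfl fun j _ => by ring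
  -- ⟨w, Hw⟩ ≤ ⟨w, G⟩ + (σ/2) S
  have h1 : w ⬝ᵥ H.mulVec w ≤ w ⬝ᵥ G + σ / 2 * S := by
    have h2 := herr w
    rw [hww] at h2
    linarith [hlhs, hsplit]
  -- Cauchy–Schwarz: ⟨w, G⟩² ≤ S T ≤ ((2/σ) T)²
  have hCS : (w ⬝ᵥ G) ^ 2 ≤ S * T := by
    have h := Finset.sum_mul_sq_le_sq_mul_sq univ w G
    have e1 : w ⬝ᵥ G = ∑ i, w i * G i := rfl
    have e2 : S = ∑ i, w i ^ 2 := by simp only [hS, hw]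
    have e3 : T = ∑ i, G i ^ 2 := by simp only [hT, hG]
    rw [e1, e2, e3]
    exact h
  have h3 : (w ⬝ᵥ G) ^ 2 ≤ (2 / σ * T) ^ 2 := by
    calc (w ⬝ᵥ G) ^ 2 ≤ S * T := hCS
      _ ≤ ((2 / σ) ^ 2 * T) * T := mul_le_mul_of_nonneg_right hST hT0
      _ = (2 / σ * T) ^ 2 := by ring
  have h4 : w ⬝ᵥ G ≤ 2 / σ * T := (abs_le_of_sq_le_sq' h3 (by positivity)).2
  have h5 : σ / 2 * S ≤ 2 / σ * T := by
    calc σ / 2 * S ≤ σ / 2 * ((2 / σ) ^ 2 * T) := mul_le_mul_of_nonneg_left hST (by positivity)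
      _ = 2 / σ * T := by field_simp
  calc w ⬝ᵥ H.mulVec w ≤ 2 / σ * T + 2 / σ * T := by linarith
    _ = 4 / σ * T := by ring

/-! ## §2  The energy of `H = lap c + Σ_b m_b u_b ⊗ u_b` controls the bond gradient -/

/-- `⟨w, Hw⟩ = ½ Σ_{j,k} c_jk (w_j − w_k)² + Σ_b m_b ⟨u_b, w⟩²` for `H = lap c + Σ_b m_b u_b ⊗ u_b`, `c` symmetric.
[folklore] -/
theorem form_lap_add_blocks [DecidableEq ι] {β : Type*} [Fintype β] (c : ι → ι → ℝ) (hcs : ∀ j k, c j k = c k j)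
    (m : β → ℝ) (u : β → ι → ℝ) (H : Matrix ι ι ℝ) (hH : ∀ j k, H j k = lap c j k + ∑ b, m b * (u b j * u b k))
    (w : ι → ℝ) :
    w ⬝ᵥ H.mulVec w = (∑ j, ∑ k, c j k * (w j - w k) ^ 2) / 2 + ∑ b, m b * (∑ i, u b i * w i) ^ 2 := by
  have h1 : ∀ j, ∑ k, H j k * w k = (∑ k, lap c j k * w k) + ∑ k, (∑ b, m b * (u b j * u b k)) * w k := by
    intro j
    rw [← Finset.sum_add_distrib]
    exact Finset.sum_congr rfl fun k _ => by rw [hH j k, add_mul]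
  calc w ⬝ᵥ H.mulVec w = ∑ j, w j * ((∑ k, lap c j k * w k) + ∑ k, (∑ b, m b * (u b j * u b k)) * w k) := by
        simp only [dotProduct, mulVec]
        exact Finset.sum_congr rfl fun j _ => by rw [h1 j]
    _ = (∑ j, w j * ∑ k, lap c j k * w k) + ∑ j, w j * ∑ k, (∑ b, m b * (u b j * u b k)) * w k := by
        rw [← Finset.sum_add_distrib]
        exact Finset.sum_congr rfl fun j _ => mul_add _ _ _
    _ = w ⬝ᵥ (lap c).mulVec w + ∑ b, m b * (∑ i, u b i * w i) ^ 2 := by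
        rw [quadForm_rankOne_sum]; rfl
    _ = (∑ j, ∑ k, c j k * (w j - w k) ^ 2) / 2 + ∑ b, m b * (∑ i, u b i * w i) ^ 2 := by
        rw [lap_form c hcs w]

/-- `½ Σ_{j,k} c_jk (w_j − w_k)² ≤ ⟨w, Hw⟩` when the block strengths `m_b` are `≥ 0`. [folklore] -/
theorem gradSq_le_form [DecidableEq ι] {β : Type*} [Fintype β] (c : ι → ι → ℝ) (hcs : ∀ j k, c j k = c k j)
    (m : β → ℝ) (hm : ∀ b, 0 ≤ m b) (u : β → ι → ℝ) (H : Matrix ι ι ℝ)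
    (hH : ∀ j k, H j k = lap c j k + ∑ b, m b * (u b j * u b k)) (w : ι → ℝ) :
    (∑ j, ∑ k, c j k * (w j - w k) ^ 2) / 2 ≤ w ⬝ᵥ H.mulVec w := by
  rw [form_lap_add_blocks c hcs m u H hH w]
  have : 0 ≤ ∑ b, m b * (∑ i, u b i * w i) ^ 2 := Finset.sum_nonneg fun b _ => mul_nonneg (hm b) (sq_nonneg _)
  linarith

/-- row sums: if every nonzero `c j k` equals `η⁻²` and there are at most `z` of them, `Σ_k c_jk ≤ z η⁻²`.
[folklore] -/
theorem rowSum_le (c : ι → ι → ℝ) (j : ι) {η z : ℝ} (hc : ∀ k, c j k ≠ 0 → c j k = (η ^ 2)⁻¹)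
    (hz : ((univ.filter fun k => c j k ≠ 0).card : ℝ) ≤ z) : ∑ k, c j k ≤ z * (η ^ 2)⁻¹ := by
  have h1 : ∑ k, c j k = ∑ k ∈ univ.filter (fun k => c j k ≠ 0), c j k := by
    rw [Finset.sum_filter]
    refine Finset.sum_congr rfl fun k _ => ?_
    by_cases h : c j k ≠ 0
    · rw [if_pos h]
    · rw [if_neg h, not_not.mp h]
  have h2 : ∑ k ∈ univ.filter (fun k => c j k ≠ 0), c j k =
      ((univ.filter fun k => c j k ≠ 0).card : ℝ) * (η ^ 2)⁻¹ := by
    rw [Finset.sum_congr rfl fun k hk => hc k (Finset.mem_filter.mp hk).2, Finset.sum_const, nsmul_eq_mul]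
  rw [h1, h2]
  exact mul_le_mul_of_nonneg_right hz (by positivity)

/-! ## §3  The weighted gradient bound -/

/-- **The weighted gradient bound.**  `H = lap c + Σ_b m_b u_b ⊗ u_b` (`c` symmetric `≥ 0`, `m ≥ 0`) with
coercivity `σ` and defect `≥ −(σ/2)‖w‖²` for the weight `φ`; if `|e^{φ_j − φ_k} − 1| ≤ ε` across bonds (`c_jk ≠ 0`)
and the row sums are `≤ ρ` (`ρ ≥ 0`), then every solution of `Hv = g` satisfies
`Σ_{j,k} c_jk (e^{φ_j}(v_j − v_k))² ≤ (16/σ + 8ε²ρ/σ²) Σ_j (e^{φ_j} g_j)²`.  (Bond algebra: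
`e^{φ_j}(v_j − v_k) = (w_j − w_k) − (e^{φ_j−φ_k} − 1) w_k`, `w = e^{φ}v`; then §1–§2 and the sibling's
`‖w‖² ≤ (2/σ)²‖e^{φ}g‖²`.) [cite: CombesThomas1973, §II] [folklore] -/
theorem weightedGradSq_le [DecidableEq ι] {β : Type*} [Fintype β]
    (c : ι → ι → ℝ) (hcs : ∀ j k, c j k = c k j) (hc0 : ∀ j k, 0 ≤ c j k)
    (m : β → ℝ) (hm : ∀ b, 0 ≤ m b) (u : β → ι → ℝ)
    (H : Matrix ι ι ℝ) (hH : ∀ j k, H j k = lap c j k + ∑ b, m b * (u b j * u b k))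
    (σ : ℝ) (hσ : 0 < σ) (hpos : ∀ ω : ι → ℝ, σ * (ω ⬝ᵥ ω) ≤ ω ⬝ᵥ H.mulVec ω) (φ : ι → ℝ)
    (herr : ∀ w : ι → ℝ,
      -(σ / 2) * (w ⬝ᵥ w) ≤ ∑ j, ∑ k, (Real.exp (φ j - φ k) - 1) * H j k * (w j * w k))
    {ε ρ : ℝ} (hε : ∀ j k, c j k ≠ 0 → |Real.exp (φ j - φ k) - 1| ≤ ε) (hρ0 : 0 ≤ ρ)
    (hρ : ∀ k, ∑ j, c j k ≤ ρ) (g v : ι → ℝ) (hv : H.mulVec v = g) :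
    ∑ j, ∑ k, c j k * (Real.exp (φ j) * (v j - v k)) ^ 2
      ≤ (16 / σ + 8 * ε ^ 2 * ρ / σ ^ 2) * ∑ j, (Real.exp (φ j) * g j) ^ 2 := by
  have hσ0 : σ ≠ 0 := hσ.ne'
  have hST := combesThomas_form_op H σ φ hσ hpos herr g v hv
  have hE := combesThomas_energy_op H σ φ hσ hpos herr g v hv
  have hgrad := gradSq_le_form c hcs m hm u H hH (fun j => Real.exp (φ j) * v j)
  -- per-bond algebra (`(X − Y)² ≤ 2X² + 2Y²`)
  have hXY : ∀ X Y : ℝ, (X - Y) ^ 2 ≤ 2 * X ^ 2 + 2 * Y ^ 2 := fun X Y => by nlinarith [sq_nonneg (X + Y)]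
  have hterm : ∀ j k, c j k * (Real.exp (φ j) * (v j - v k)) ^ 2 ≤
      2 * (c j k * (Real.exp (φ j) * v j - Real.exp (φ k) * v k) ^ 2)
        + 2 * ε ^ 2 * (c j k * (Real.exp (φ k) * v k) ^ 2) := by
    intro j k
    by_cases hjk : c j k = 0
    · simp [hjk]
    · have hid : Real.exp (φ j) * (v j - v k) =
          (Real.exp (φ j) * v j - Real.exp (φ k) * v k) - (Real.exp (φ j - φ k) - 1) * (Real.exp (φ k) * v k) := by
        rw [Real.exp_sub]
        field_simp
        ring
      have hb := abs_le.mp (hε j k hjk)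
      have hY : ((Real.exp (φ j - φ k) - 1) * (Real.exp (φ k) * v k)) ^ 2 ≤ ε ^ 2 * (Real.exp (φ k) * v k) ^ 2 := by
        rw [mul_pow]
        exact mul_le_mul_of_nonneg_right (sq_le_sq' hb.1 hb.2) (sq_nonneg _)
      rw [hid]
      calc c j k * ((Real.exp (φ j) * v j - Real.exp (φ k) * v k)
              - (Real.exp (φ j - φ k) - 1) * (Real.exp (φ k) * v k)) ^ 2
          ≤ c j k * (2 * (Real.exp (φ j) * v j - Real.exp (φ k) * v k) ^ 2
              + 2 * ((Real.exp (φ j - φ k) - 1) * (Real.exp (φ k) * v k)) ^ 2) :=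
            mul_le_mul_of_nonneg_left (hXY _ _) (hc0 j k)
        _ ≤ c j k * (2 * (Real.exp (φ j) * v j - Real.exp (φ k) * v k) ^ 2
              + 2 * (ε ^ 2 * (Real.exp (φ k) * v k) ^ 2)) :=
            mul_le_mul_of_nonneg_left (by linarith [hY]) (hc0 j k)
        _ = 2 * (c j k * (Real.exp (φ j) * v j - Real.exp (φ k) * v k) ^ 2)
              + 2 * ε ^ 2 * (c j k * (Real.exp (φ k) * v k) ^ 2) := by ring
  -- sum the bond algebra
  have hsum : ∑ j, ∑ k, c j k * (Real.exp (φ j) * (v j - v k)) ^ 2 ≤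
      2 * ∑ j, ∑ k, c j k * (Real.exp (φ j) * v j - Real.exp (φ k) * v k) ^ 2
        + 2 * ε ^ 2 * ∑ j, ∑ k, c j k * (Real.exp (φ k) * v k) ^ 2 := by
    calc ∑ j, ∑ k, c j k * (Real.exp (φ j) * (v j - v k)) ^ 2
        ≤ ∑ j, ∑ k, (2 * (c j k * (Real.exp (φ j) * v j - Real.exp (φ k) * v k) ^ 2)
            + 2 * ε ^ 2 * (c j k * (Real.exp (φ k) * v k) ^ 2)) :=
          Finset.sum_le_sum fun j _ => Finset.sum_le_sum fun k _ => hterm j k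
      _ = 2 * ∑ j, ∑ k, c j k * (Real.exp (φ j) * v j - Real.exp (φ k) * v k) ^ 2
            + 2 * ε ^ 2 * ∑ j, ∑ k, c j k * (Real.exp (φ k) * v k) ^ 2 := by
          simp only [Finset.mul_sum, Finset.sum_add_distrib]
  -- the gradient part: `Σ c (w_j − w_k)² ≤ 2 ⟨w,Hw⟩ ≤ (8/σ) T`
  have hA : ∑ j, ∑ k, c j k * (Real.exp (φ j) * v j - Real.exp (φ k) * v k) ^ 2 ≤
      8 / σ * ∑ j, (Real.exp (φ j) * g j) ^ 2 := by
    have h2 : (∑ j, ∑ k, c j k * (Real.exp (φ j) * v j - Real.exp (φ k) * v k) ^ 2) / 2 ≤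
        4 / σ * ∑ j, (Real.exp (φ j) * g j) ^ 2 := hgrad.trans hE
    calc ∑ j, ∑ k, c j k * (Real.exp (φ j) * v j - Real.exp (φ k) * v k) ^ 2
        = 2 * ((∑ j, ∑ k, c j k * (Real.exp (φ j) * v j - Real.exp (φ k) * v k) ^ 2) / 2) := by ring
      _ ≤ 2 * (4 / σ * ∑ j, (Real.exp (φ j) * g j) ^ 2) := mul_le_mul_of_nonneg_left h2 zero_le_two
      _ = 8 / σ * ∑ j, (Real.exp (φ j) * g j) ^ 2 := by ring
  -- the weight-variation part: row sums
  have hB : ∑ j, ∑ k, c j k * (Real.exp (φ k) * v k) ^ 2 ≤ ρ * ∑ k, (Real.exp (φ k) * v k) ^ 2 := by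
    rw [Finset.sum_comm]
    calc ∑ k, ∑ j, c j k * (Real.exp (φ k) * v k) ^ 2 = ∑ k, (∑ j, c j k) * (Real.exp (φ k) * v k) ^ 2 :=
          Finset.sum_congr rfl fun k _ => by rw [Finset.sum_mul]
      _ ≤ ∑ k, ρ * (Real.exp (φ k) * v k) ^ 2 :=
          Finset.sum_le_sum fun k _ => mul_le_mul_of_nonneg_right (hρ k) (sq_nonneg _)
      _ = ρ * ∑ k, (Real.exp (φ k) * v k) ^ 2 := by rw [← Finset.mul_sum]
  have hT0 : 0 ≤ ∑ j, (Real.exp (φ j) * g j) ^ 2 := Finset.sum_nonneg fun j _ => sq_nonneg _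
  have hB' : ∑ j, ∑ k, c j k * (Real.exp (φ k) * v k) ^ 2 ≤ ρ * ((2 / σ) ^ 2 * ∑ j, (Real.exp (φ j) * g j) ^ 2) :=
    hB.trans (mul_le_mul_of_nonneg_left hST hρ0)
  have hε2 : 0 ≤ 2 * ε ^ 2 := by positivity
  calc ∑ j, ∑ k, c j k * (Real.exp (φ j) * (v j - v k)) ^ 2
      ≤ 2 * (8 / σ * ∑ j, (Real.exp (φ j) * g j) ^ 2)
          + 2 * ε ^ 2 * (ρ * ((2 / σ) ^ 2 * ∑ j, (Real.exp (φ j) * g j) ^ 2)) :=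
        hsum.trans (add_le_add (mul_le_mul_of_nonneg_left hA zero_le_two) (mul_le_mul_of_nonneg_left hB' hε2))
    _ = (16 / σ + 8 * ε ^ 2 * ρ / σ ^ 2) * ∑ j, (Real.exp (φ j) * g j) ^ 2 := by ring

/-- **Set-to-set decay of the gradient, operator form.**  Under the hypotheses of `weightedGradSq_le`: if `g` is
supported in `T`, `φ ≤ hi` on `T` and `lo ≤ φ` on `S`, then
`Σ_{j∈S} Σ_k c_jk (v_j − v_k)² ≤ (16/σ + 8ε²ρ/σ²) e^{−2(lo − hi)} Σ_j g_j²`. [cite: CombesThomas1973, §II] [folklore] -/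
theorem gradDecay_set_form_op [DecidableEq ι] {β : Type*} [Fintype β]
    (c : ι → ι → ℝ) (hcs : ∀ j k, c j k = c k j) (hc0 : ∀ j k, 0 ≤ c j k)
    (m : β → ℝ) (hm : ∀ b, 0 ≤ m b) (u : β → ι → ℝ)
    (H : Matrix ι ι ℝ) (hH : ∀ j k, H j k = lap c j k + ∑ b, m b * (u b j * u b k))
    (σ : ℝ) (hσ : 0 < σ) (hpos : ∀ ω : ι → ℝ, σ * (ω ⬝ᵥ ω) ≤ ω ⬝ᵥ H.mulVec ω) (φ : ι → ℝ)
    (herr : ∀ w : ι → ℝ,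
      -(σ / 2) * (w ⬝ᵥ w) ≤ ∑ j, ∑ k, (Real.exp (φ j - φ k) - 1) * H j k * (w j * w k))
    {ε ρ : ℝ} (hε : ∀ j k, c j k ≠ 0 → |Real.exp (φ j - φ k) - 1| ≤ ε) (hρ0 : 0 ≤ ρ)
    (hρ : ∀ k, ∑ j, c j k ≤ ρ)
    (S T : Finset ι) (lo hi : ℝ) (hlo : ∀ i ∈ S, lo ≤ φ i) (hhi : ∀ j ∈ T, φ j ≤ hi)
    (g v : ι → ℝ) (hg : ∀ j, j ∉ T → g j = 0) (hv : H.mulVec v = g) :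
    ∑ j ∈ S, ∑ k, c j k * (v j - v k) ^ 2
      ≤ (16 / σ + 8 * ε ^ 2 * ρ / σ ^ 2) * Real.exp (-(2 * (lo - hi))) * ∑ j, g j ^ 2 := by
  have h1 : ∑ j ∈ S, ∑ k, c j k * (v j - v k) ^ 2 ≤
      Real.exp (-(2 * lo)) * ∑ j, ∑ k, c j k * (Real.exp (φ j) * (v j - v k)) ^ 2 := by
    calc ∑ j ∈ S, ∑ k, c j k * (v j - v k) ^ 2
        ≤ ∑ j ∈ S, ∑ k, Real.exp (-(2 * lo)) * (c j k * (Real.exp (φ j) * (v j - v k)) ^ 2) := by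
          refine Finset.sum_le_sum fun j hj => Finset.sum_le_sum fun k _ => ?_
          have e1 : (1 : ℝ) ≤ Real.exp (-(2 * lo)) * Real.exp (φ j) ^ 2 := by
            rw [← Real.exp_nat_mul, ← Real.exp_add]
            exact Real.one_le_exp (by push_cast; linarith [hlo j hj])
          calc c j k * (v j - v k) ^ 2 = 1 * (c j k * (v j - v k) ^ 2) := (one_mul _).symm
            _ ≤ (Real.exp (-(2 * lo)) * Real.exp (φ j) ^ 2) * (c j k * (v j - v k) ^ 2) :=
                mul_le_mul_of_nonneg_right e1 (mul_nonneg (hc0 j k) (sq_nonneg _))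
            _ = Real.exp (-(2 * lo)) * (c j k * (Real.exp (φ j) * (v j - v k)) ^ 2) := by ring
      _ = Real.exp (-(2 * lo)) * ∑ j ∈ S, ∑ k, c j k * (Real.exp (φ j) * (v j - v k)) ^ 2 := by
          simp only [Finset.mul_sum]
      _ ≤ Real.exp (-(2 * lo)) * ∑ j, ∑ k, c j k * (Real.exp (φ j) * (v j - v k)) ^ 2 := by
          refine mul_le_mul_of_nonneg_left ?_ (Real.exp_pos _).le
          exact Finset.sum_le_sum_of_subset_of_nonneg (Finset.subset_univ S) fun j _ _ =>
            Finset.sum_nonneg fun k _ => mul_nonneg (hc0 j k) (sq_nonneg _)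
  have h2 := weightedGradSq_le c hcs hc0 m hm u H hH σ hσ hpos φ herr hε hρ0 hρ g v hv
  have h3 := weightedSq_le_of_support φ g T hi hg hhi
  have hg0 : 0 ≤ ∑ j, g j ^ 2 := Finset.sum_nonneg fun j _ => sq_nonneg _
  have hK : 0 ≤ 16 / σ + 8 * ε ^ 2 * ρ / σ ^ 2 := by positivity
  have hexp : Real.exp (-(2 * (lo - hi))) = Real.exp (-(2 * lo)) * Real.exp (2 * hi) := by
    rw [← Real.exp_add]; ring_nf
  calc ∑ j ∈ S, ∑ k, c j k * (v j - v k) ^ 2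
      ≤ Real.exp (-(2 * lo)) * ∑ j, ∑ k, c j k * (Real.exp (φ j) * (v j - v k)) ^ 2 := h1
    _ ≤ Real.exp (-(2 * lo)) * ((16 / σ + 8 * ε ^ 2 * ρ / σ ^ 2) * (Real.exp (2 * hi) * ∑ j, g j ^ 2)) := by
        refine mul_le_mul_of_nonneg_left ?_ (Real.exp_pos _).le
        exact h2.trans (mul_le_mul_of_nonneg_left h3 hK)
    _ = (16 / σ + 8 * ε ^ 2 * ρ / σ ^ 2) * Real.exp (-(2 * (lo - hi))) * ∑ j, g j ^ 2 := by rw [hexp]; ring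

/-! ## §4  The lattice shape, metric form — the constant is `η`-free -/

/-- **Set-to-set decay of the gradient in the lattice shape, metric form** (hypotheses VERBATIM those of
`CombesThomasFormOp.setDecay_lattice_dist`): `H = lap c + Σ_b m_b u_b ⊗ u_b` with bond coefficients `η⁻²` on at
most `z` neighbours of `d`-length `≤ η`, blocks of `d`-diameter `≤ D` with strengths `m_b‖u_b‖² ≤ a`, coercivity
`σ`, `0 ≤ δ`, `δη ≤ 1`, the `η`-free smallness `zδ² + a(e^{δD} − 1) ≤ σ/2`; then for `g` supported in `T ≠ ∅`,
`S` at `d`-distance `≥ R` from `T` and `Hv = g`: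
`Σ_{j∈S} Σ_k c_jk (v_j − v_k)² ≤ (16/σ + 32zδ²/σ²) e^{−2δR} Σ_j g_j²` — the weight is `δ·dist(·,T)`, whose bond
oscillation `≤ δη ≤ 1` gives `ε = 2δη`, and the row sums are `≤ zη⁻²`, so `8ε²ρ = 32zδ²`: NO `η`.
[cite: CombesThomas1973, §II] [folklore] -/
theorem gradDecay_lattice_dist [DecidableEq ι] {β : Type*} [Fintype β] [DecidableEq β]
    (c : ι → ι → ℝ) (hcs : ∀ j k, c j k = c k j) (hc0 : ∀ j k, 0 ≤ c j k)
    (blk : ι → β) (m : β → ℝ) (hm : ∀ b, 0 ≤ m b) (u : β → ι → ℝ) (hu : ∀ b j, blk j ≠ b → u b j = 0)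
    (H : Matrix ι ι ℝ) (hH : ∀ j k, H j k = lap c j k + ∑ b, m b * (u b j * u b k))
    (σ : ℝ) (hσ : 0 < σ) (hpos : ∀ ω : ι → ℝ, σ * (ω ⬝ᵥ ω) ≤ ω ⬝ᵥ H.mulVec ω)
    (d : ι → ι → ℝ) (hd0 : ∀ i, d i i = 0) (hds : ∀ i j, d i j = d j i)
    (hdt : ∀ i j k, d i k ≤ d i j + d j k)
    {η δ z a D : ℝ} (hη : 0 < η) (hδ : 0 ≤ δ) (h1 : δ * η ≤ 1) (hD : 0 ≤ D)
    (hc : ∀ j k, c j k ≠ 0 → c j k = (η ^ 2)⁻¹ ∧ d j k ≤ η)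
    (hz : ∀ j, ((univ.filter fun k => c j k ≠ 0).card : ℝ) ≤ z)
    (hblk : ∀ j k, blk j = blk k → d j k ≤ D)
    (ha : ∀ b, m b * ∑ k, u b k ^ 2 ≤ a)
    (hsmall : z * δ ^ 2 + a * (Real.exp (δ * D) - 1) ≤ σ / 2)
    (S T : Finset ι) (hT : T.Nonempty) (R : ℝ) (hR : ∀ i ∈ S, ∀ t ∈ T, R ≤ d i t)
    (g v : ι → ℝ) (hg : ∀ j, j ∉ T → g j = 0) (hv : H.mulVec v = g) :
    ∑ j ∈ S, ∑ k, c j k * (v j - v k) ^ 2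
      ≤ (16 / σ + 32 * z * δ ^ 2 / σ ^ 2) * Real.exp (-(2 * (δ * R))) * ∑ j, g j ^ 2 := by
  have hη0 : η ≠ 0 := hη.ne'
  obtain ⟨t₀, ht₀⟩ := hT
  have hz0 : 0 ≤ z := le_trans (Nat.cast_nonneg _) (hz t₀)
  set φ : ι → ℝ := fun j => δ * distTo d T ⟨t₀, ht₀⟩ j with hφ
  have hlip : ∀ j k, |φ j - φ k| ≤ δ * d j k := by
    intro j k
    simp only [hφ]
    rw [← mul_sub, abs_mul, abs_of_nonneg hδ]
    exact mul_le_mul_of_nonneg_left (abs_distTo_sub_le d hds hdt T ⟨t₀, ht₀⟩ j k) hδ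
  -- the conjugation defect of `φ` (as in the sibling `setDecay_lattice`)
  have hε0 : 0 ≤ Real.exp (δ * D) - 1 := by linarith [Real.add_one_le_exp (δ * D), mul_nonneg hδ hD]
  have herr : ∀ w : ι → ℝ,
      -(σ / 2) * (w ⬝ᵥ w) ≤ ∑ j, ∑ k, (Real.exp (φ j - φ k) - 1) * H j k * (w j * w k) := by
    intro w
    have h := CombesThomasFormOp.conjError_lap_add_blocks_ge c hcs hc0 blk m hm u hu H hH φ (z * δ ^ 2)
      (a * (Real.exp (δ * D) - 1))
      (CombesThomasForm.lapDefect_le c φ hη h1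
        (fun j k hjk => ⟨(hc j k hjk).1, (hlip j k).trans (mul_le_mul_of_nonneg_left (hc j k hjk).2 hδ)⟩) hz)
      (fun _ => Real.exp (δ * D) - 1) (fun _ => hε0)
      (fun b j k hj hk => CombesThomasForm.blockDefect_le blk φ (δ * D)
        (fun j k hjk => (hlip j k).trans (mul_le_mul_of_nonneg_left (hblk j k hjk) hδ)) b j k hj hk)
      (fun b => by
        calc m b * (Real.exp (δ * D) - 1) * ∑ k, u b k ^ 2 = (Real.exp (δ * D) - 1) * (m b * ∑ k, u b k ^ 2) := by
              ring
          _ ≤ (Real.exp (δ * D) - 1) * a := mul_le_mul_of_nonneg_left (ha b) hε0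
          _ = a * (Real.exp (δ * D) - 1) := mul_comm _ _) w
    have hww : 0 ≤ w ⬝ᵥ w := Finset.sum_nonneg fun j _ => mul_self_nonneg _
    nlinarith
  -- bond oscillation of the weight: `ε = 2δη`
  have hε : ∀ j k, c j k ≠ 0 → |Real.exp (φ j - φ k) - 1| ≤ 2 * (δ * η) := by
    intro j k hjk
    have hb : |φ j - φ k| ≤ δ * η := (hlip j k).trans (mul_le_mul_of_nonneg_left (hc j k hjk).2 hδ)
    calc |Real.exp (φ j - φ k) - 1| ≤ 2 * |φ j - φ k| := Real.abs_exp_sub_one_le (hb.trans h1)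
      _ ≤ 2 * (δ * η) := by linarith
  -- row sums: `ρ = z η⁻²` (columns = rows by symmetry)
  have hρ : ∀ k, ∑ j, c j k ≤ z * (η ^ 2)⁻¹ := by
    intro k
    have e : ∑ j, c j k = ∑ j, c k j := Finset.sum_congr rfl fun j _ => hcs j k
    rw [e]
    exact rowSum_le c k (fun j hj => (hc k j hj).1) (hz k)
  have h := gradDecay_set_form_op c hcs hc0 m hm u H hH σ hσ hpos φ herr hε (by positivity) hρ S T (δ * R) 0
    (fun i hi => mul_le_mul_of_nonneg_left (le_distTo d T ⟨t₀, ht₀⟩ fun t ht => hR i hi t ht) hδ)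
    (fun j hj => mul_nonpos_iff.2 (Or.inl ⟨hδ, distTo_le_zero_of_mem d hd0 T ⟨t₀, ht₀⟩ hj⟩))
    g v hg hv
  have hconst : 16 / σ + 8 * (2 * (δ * η)) ^ 2 * (z * (η ^ 2)⁻¹) / σ ^ 2 = 16 / σ + 32 * z * δ ^ 2 / σ ^ 2 := by
    field_simp
    ring
  rw [hconst, sub_zero] at h
  exact h

end Generic

/-! ## §5  The torus instantiation -/

section Torus

variable {d : ℕ} (N : Fin d → ℕ) [hN : ∀ μ, NeZero (N μ)]

/-- on the torus with periods `≥ 3`, a nearest-neighbour coupling sum lists the `2d` neighbours: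
`Σ_k c_{xk} F(k) = γ Σ_μ (F(x+e_μ) + F(x−e_μ))`. [folklore] -/
theorem sum_coupling_mul (h3 : ∀ μ, 3 ≤ N μ) (γ : ℝ) (F : Tor N → ℝ) (x : Tor N) :
    ∑ k, coupling N γ x k * F k = γ * ∑ μ, (F (x + unitVec N μ) + F (x - unitVec N μ)) := by
  classical
  by_cases hγ : γ = 0
  · subst hγ
    have h0 : ∀ k, coupling N 0 x k = 0 := fun k => by unfold coupling; split_ifs <;> rfl
    simp [h0]
  have hrestrict : ∑ k, coupling N γ x k * F k =
      ∑ k ∈ univ.filter (fun x' => coupling N γ x x' ≠ 0), coupling N γ x k * F k := by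
    rw [Finset.sum_filter]
    refine Finset.sum_congr rfl fun k _ => ?_
    by_cases h : coupling N γ x k ≠ 0
    · rw [if_pos h]
    · rw [if_neg h, not_not.mp h, zero_mul]
  rw [hrestrict, filter_adj_eq_image N γ hγ x, Finset.sum_image fun p _ q _ h => pm_injective N h3 x h,
    Fintype.sum_prod_type, Finset.mul_sum]
  refine Finset.sum_congr rfl fun μ _ => ?_
  rw [Fintype.sum_bool]
  simp only [ite_true, Bool.false_eq_true, ite_false]
  rw [coupling_bond, show coupling N γ x (x - unitVec N μ) = γ by
    unfold coupling; rw [if_pos ⟨μ, Or.inr (by simp)⟩]]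
  ring

variable (n : ℕ) (M : Fin d → ℕ) [hM : ∀ μ, NeZero (M μ)]

/-- **`η`-uniform `L²` set-to-set decay of the lattice gradient of solutions of `(−Δ^η + aQ*Q) v = g`.**  Periods
`(n+1)M_μ ≥ 3`, `a > 0`, `0 ≤ δ ≤ 1`, `2dδ² + a(e^δ − 1) ≤ min(2,a)/2`, `g` supported in `T ≠ ∅`, `edist(S,T) ≥ R`:
`Σ_{x∈S} (n+1)² Σ_μ [(v(x) − v(x+e_μ))² + (v(x) − v(x−e_μ))²] ≤ (32/min(2,a)) e^{−2δR} Σ_x g(x)²` — i.e. the forward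
and backward gradients `η⁻¹(v(x±e_μ) − v(x))` restricted to `S` have `ℓ²` mass `≤ √(32/min(2,a)) e^{−δR} ‖g‖`,
uniformly in the mesh `η = 1/(n+1)`. [cite: CombesThomas1973, §II] [folklore] -/
theorem gradDecay_torus (h3 : ∀ μ, 3 ≤ fine (n + 1) M μ) {a δ : ℝ} (ha : 0 < a) (hδ0 : 0 ≤ δ) (hδ1 : δ ≤ 1)
    (hsmall : 2 * (d : ℝ) * δ ^ 2 + a * (Real.exp δ - 1) ≤ min 2 a / 2)
    (S T : Finset (Tor (fine (n + 1) M))) (hT : T.Nonempty) (R : ℝ)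
    (hR : ∀ x ∈ S, ∀ t ∈ T, R ≤ edist n M x t)
    (g v : Tor (fine (n + 1) M) → ℝ) (hg : ∀ x, x ∉ T → g x = 0) (hv : (torusOp n M a).mulVec v = g) :
    ∑ x ∈ S, ((n : ℝ) + 1) ^ 2 * ∑ μ : Fin d,
        ((v x - v (x + unitVec (fine (n + 1) M) μ)) ^ 2 + (v x - v (x - unitVec (fine (n + 1) M) μ)) ^ 2)
      ≤ 32 / min 2 a * Real.exp (-(2 * (δ * R))) * ∑ x, g x ^ 2 := by
  classical
  have h2 : ∀ μ, 2 ≤ fine (n + 1) M μ := fun μ => (by norm_num : 2 ≤ 3).trans (h3 μ)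
  have hn1 : (0 : ℝ) < (n : ℝ) + 1 := by positivity
  have hγ0 : (0 : ℝ) < ((n : ℝ) + 1) ^ 2 := by positivity
  have hη : (0 : ℝ) < 1 / ((n : ℝ) + 1) := by positivity
  have hη1 : 1 / ((n : ℝ) + 1) ≤ 1 := by rw [div_le_one hn1]; linarith
  have hσ : 0 < min 2 a := lt_min (by norm_num) ha
  have h : ∑ x ∈ S, ∑ k, coupling (fine (n + 1) M) (((n : ℝ) + 1) ^ 2) x k * (v x - v k) ^ 2 ≤
      (16 / min 2 a + 32 * (2 * (d : ℝ)) * δ ^ 2 / min 2 a ^ 2) * Real.exp (-(2 * (δ * R))) * ∑ x, g x ^ 2 := by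
    refine gradDecay_lattice_dist (coupling (fine (n + 1) M) (((n : ℝ) + 1) ^ 2)) (coupling_symm _ _)
      (coupling_nonneg _ hγ0.le)
      (B5Blocks16.blockOf (n + 1) M)
      (fun b => a / ((univ.filter fun i => B5Blocks16.blockOf (n + 1) M i = b).card : ℝ))
      (fun b => div_nonneg ha.le (Nat.cast_nonneg _))
      (fun b j => if B5Blocks16.blockOf (n + 1) M j = b then (1 : ℝ) else 0) (fun b j hj => if_neg hj)
      (torusOp n M a) (fun j k => rfl) (min 2 a) hσ (coercive_torus n M h3 ha.le)
      (edist n M) (fun x => by simp [TorusG0Decay.edist, ldist_self]) (fun x y => by simp [TorusG0Decay.edist, ldist_symm])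
      (fun x y z => ?_) (η := 1 / ((n : ℝ) + 1)) (δ := δ) (z := 2 * d) (a := a) (D := 1) hη hδ0 ?_ zero_le_one
      (fun j k hjk => ?_) (fun j => card_coupling_ne_zero_le _ _ j) (fun j k hjk => ?_) (fun b => ?_) ?_
      S T hT R hR g v hg hv
    · -- triangle inequality
      simp only [TorusG0Decay.edist]; rw [← mul_add]
      exact mul_le_mul_of_nonneg_left (ldist_triangle _ x y z) hη.le
    · -- δη ≤ 1
      calc δ * (1 / ((n : ℝ) + 1)) ≤ 1 * 1 := mul_le_mul hδ1 hη1 hη.le zero_le_one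
        _ = 1 := one_mul 1
    · -- bonds: coefficient η⁻² and length ≤ η
      obtain ⟨hadj, hval⟩ := adj_of_coupling_ne_zero _ hjk
      refine ⟨?_, ?_⟩
      · rw [hval]; field_simp
      · show (1 / ((n : ℝ) + 1)) * ldist (fine (n + 1) M) j k ≤ 1 / ((n : ℝ) + 1)
        calc (1 / ((n : ℝ) + 1)) * ldist (fine (n + 1) M) j k ≤ (1 / ((n : ℝ) + 1)) * 1 :=
              mul_le_mul_of_nonneg_left (ldist_le_one_of_adj _ h2 hadj) hη.le
          _ = 1 / ((n : ℝ) + 1) := mul_one _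
    · -- blocks have `edist`-diameter ≤ 1
      show (1 / ((n : ℝ) + 1)) * ldist (fine (n + 1) M) j k ≤ 1
      calc (1 / ((n : ℝ) + 1)) * ldist (fine (n + 1) M) j k ≤ (1 / ((n : ℝ) + 1)) * n :=
            mul_le_mul_of_nonneg_left (ldist_le_of_same_block n M hjk) hη.le
        _ ≤ 1 := by rw [div_mul_eq_mul_div, one_mul, div_le_one hn1]; linarith
    · -- block strengths: (a/|B|)·|B| = a
      rw [sum_blockInd_sq, div_mul_cancel₀ a (card_block_ne_zero n M b)]
    · -- smallness
      simpa [mul_one] using hsmall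
  -- list the neighbours
  have hL : ∀ x, ∑ k, coupling (fine (n + 1) M) (((n : ℝ) + 1) ^ 2) x k * (v x - v k) ^ 2 =
      ((n : ℝ) + 1) ^ 2 * ∑ μ : Fin d,
        ((v x - v (x + unitVec (fine (n + 1) M) μ)) ^ 2 + (v x - v (x - unitVec (fine (n + 1) M) μ)) ^ 2) :=
    fun x => sum_coupling_mul (fine (n + 1) M) h3 _ (fun k => (v x - v k) ^ 2) x
  -- the constant: `16/σ + 32·(2d)δ²/σ² ≤ 32/σ` because `2dδ² ≤ σ/2`
  have hzd : 2 * (d : ℝ) * δ ^ 2 ≤ min 2 a / 2 := by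
    have : 0 ≤ a * (Real.exp δ - 1) := mul_nonneg ha.le (by linarith [Real.add_one_le_exp δ])
    linarith
  have hK : 16 / min 2 a + 32 * (2 * (d : ℝ)) * δ ^ 2 / min 2 a ^ 2 ≤ 32 / min 2 a := by
    have e1 : 32 * (2 * (d : ℝ)) * δ ^ 2 / min 2 a ^ 2 = 32 / min 2 a ^ 2 * (2 * d * δ ^ 2) := by ring
    have e2 : 32 / min 2 a ^ 2 * (min 2 a / 2) = 16 / min 2 a := by
      field_simp
      ring
    calc 16 / min 2 a + 32 * (2 * (d : ℝ)) * δ ^ 2 / min 2 a ^ 2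
        = 16 / min 2 a + 32 / min 2 a ^ 2 * (2 * d * δ ^ 2) := by rw [e1]
      _ ≤ 16 / min 2 a + 32 / min 2 a ^ 2 * (min 2 a / 2) := by gcongr
      _ = 32 / min 2 a := by rw [e2]; ring
  have hg0 : 0 ≤ ∑ x, g x ^ 2 := Finset.sum_nonneg fun x _ => sq_nonneg _
  calc ∑ x ∈ S, ((n : ℝ) + 1) ^ 2 * ∑ μ : Fin d,
          ((v x - v (x + unitVec (fine (n + 1) M) μ)) ^ 2 + (v x - v (x - unitVec (fine (n + 1) M) μ)) ^ 2)
      = ∑ x ∈ S, ∑ k, coupling (fine (n + 1) M) (((n : ℝ) + 1) ^ 2) x k * (v x - v k) ^ 2 :=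
        Finset.sum_congr rfl fun x _ => (hL x).symm
    _ ≤ (16 / min 2 a + 32 * (2 * (d : ℝ)) * δ ^ 2 / min 2 a ^ 2) * Real.exp (-(2 * (δ * R))) * ∑ x, g x ^ 2 := h
    _ ≤ 32 / min 2 a * Real.exp (-(2 * (δ * R))) * ∑ x, g x ^ 2 :=
        mul_le_mul_of_nonneg_right (mul_le_mul_of_nonneg_right hK (Real.exp_pos _).le) hg0

/-- **`η`-uniform `L²` set-to-set decay of `∇^η G₀`**: `gradDecay_torus` for `v := G₀ g`. [cite: CombesThomas1973, §II]
[folklore] -/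
theorem G0_gradDecay (h3 : ∀ μ, 3 ≤ fine (n + 1) M μ) {a δ : ℝ} (ha : 0 < a) (hδ0 : 0 ≤ δ) (hδ1 : δ ≤ 1)
    (hsmall : 2 * (d : ℝ) * δ ^ 2 + a * (Real.exp δ - 1) ≤ min 2 a / 2)
    (S T : Finset (Tor (fine (n + 1) M))) (hT : T.Nonempty) (R : ℝ)
    (hR : ∀ x ∈ S, ∀ t ∈ T, R ≤ edist n M x t)
    (g : Tor (fine (n + 1) M) → ℝ) (hg : ∀ x, x ∉ T → g x = 0) :
    ∑ x ∈ S, ((n : ℝ) + 1) ^ 2 * ∑ μ : Fin d,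
        (((G0 n M a).mulVec g x - (G0 n M a).mulVec g (x + unitVec (fine (n + 1) M) μ)) ^ 2
          + ((G0 n M a).mulVec g x - (G0 n M a).mulVec g (x - unitVec (fine (n + 1) M) μ)) ^ 2)
      ≤ 32 / min 2 a * Real.exp (-(2 * (δ * R))) * ∑ x, g x ^ 2 :=
  gradDecay_torus n M h3 ha hδ0 hδ1 hsmall S T hT R hR g _ hg (torusOp_mulVec_G0 n M h3 ha g)

/-- **Gradient entry bound**: `(n+1) |G₀(x,y) − G₀(x+e_μ,y)| ≤ √(32/min(2,a)) · e^{−δ·edist(x,y)}`, i.e. the forward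
lattice gradient `∇^η_μ` of the kernel in its first argument decays with the same `η`-free rate.
[cite: CombesThomas1973, §II] [folklore] -/
theorem G0_grad_entry_bound (h3 : ∀ μ, 3 ≤ fine (n + 1) M μ) {a δ : ℝ} (ha : 0 < a) (hδ0 : 0 ≤ δ) (hδ1 : δ ≤ 1)
    (hsmall : 2 * (d : ℝ) * δ ^ 2 + a * (Real.exp δ - 1) ≤ min 2 a / 2) (x y : Tor (fine (n + 1) M))
    (μ : Fin d) :
    ((n : ℝ) + 1) * |G0 n M a x y - G0 n M a (x + unitVec (fine (n + 1) M) μ) y|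
      ≤ Real.sqrt (32 / min 2 a) * Real.exp (-(δ * edist n M x y)) := by
  classical
  have hσ : 0 < min 2 a := lt_min two_pos ha
  have hdec := G0_gradDecay n M h3 ha hδ0 hδ1 hsmall {x} {y} (Finset.singleton_nonempty y) (edist n M x y)
    (fun x' hx' t ht => by rw [Finset.mem_singleton] at hx' ht; rw [hx', ht]) (Pi.single y 1)
    (fun j hj => by rw [Finset.mem_singleton] at hj; simp [hj])
  rw [Finset.sum_singleton, sum_single_sq, mul_one] at hdec
  simp only [G0_mulVec_single] at hdec
  -- single out the forward bond in direction μ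
  have hterm : ((n : ℝ) + 1) ^ 2 * (G0 n M a x y - G0 n M a (x + unitVec (fine (n + 1) M) μ) y) ^ 2 ≤
      ((n : ℝ) + 1) ^ 2 * ∑ ν : Fin d,
        ((G0 n M a x y - G0 n M a (x + unitVec (fine (n + 1) M) ν) y) ^ 2
          + (G0 n M a x y - G0 n M a (x - unitVec (fine (n + 1) M) ν) y) ^ 2) := by
    refine mul_le_mul_of_nonneg_left ?_ (by positivity)
    calc (G0 n M a x y - G0 n M a (x + unitVec (fine (n + 1) M) μ) y) ^ 2
        ≤ (G0 n M a x y - G0 n M a (x + unitVec (fine (n + 1) M) μ) y) ^ 2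
            + (G0 n M a x y - G0 n M a (x - unitVec (fine (n + 1) M) μ) y) ^ 2 :=
          le_add_of_nonneg_right (sq_nonneg _)
      _ ≤ ∑ ν : Fin d, ((G0 n M a x y - G0 n M a (x + unitVec (fine (n + 1) M) ν) y) ^ 2
            + (G0 n M a x y - G0 n M a (x - unitVec (fine (n + 1) M) ν) y) ^ 2) :=
          Finset.single_le_sum (f := fun ν => (G0 n M a x y - G0 n M a (x + unitVec (fine (n + 1) M) ν) y) ^ 2
            + (G0 n M a x y - G0 n M a (x - unitVec (fine (n + 1) M) ν) y) ^ 2)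
            (fun ν _ => add_nonneg (sq_nonneg _) (sq_nonneg _)) (mem_univ μ)
  have hexp : Real.exp (-(δ * edist n M x y)) ^ 2 = Real.exp (-(2 * (δ * edist n M x y))) := by
    rw [← Real.exp_nat_mul]; congr 1; push_cast; ring
  have hsq : (((n : ℝ) + 1) * |G0 n M a x y - G0 n M a (x + unitVec (fine (n + 1) M) μ) y|) ^ 2 ≤
      (Real.sqrt (32 / min 2 a) * Real.exp (-(δ * edist n M x y))) ^ 2 := by
    rw [mul_pow, sq_abs, mul_pow, Real.sq_sqrt (by positivity), hexp]
    exact hterm.trans hdec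
  exact (abs_le_of_sq_le_sq' hsq (by positivity)).2

end Torus

end

end Literature.MathematicalPhysics.QuantumFieldTheory.Balaban1983to89.Beta.TorusG0GradDecay
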